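import Summits.QuantumFields.BalabanUV.Beta.GAN24.SymContactBorderEntryBound

/-!
# `GAN24.SymContactBorderEntryBoundMf` — (B3) at an1's symmetrised tables: the mf-CHANNEL entry bound — the sym twin of leaf-03's (E) `GAN24.ContactBorderEntryBoundMf`

NOT IN PRINT — OUR BOOKKEEPING (OWNER `b2b-balaban-gan24-p1` gen 55, 2026-08-28; row G-an2-4 ∕ (CONV-C), TRANSFER-III, the (III′) S-slot (b), born-V contact letters `hCv ∕ hPcV`
of road-P2 M.104 — TABLE HALF at an1's (0.4)-SYMMETRISED border table `symVhSAt ρ` and (0.4) packed first-order kernel `linSym04At ρ L` (the OWNER's memo `HCV-DESIGN-g55.md` §1∕§2):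
a mkroot-style token re-run of the (E) file named below with `vhSAt ρ ↦ symVhSAt ρ`, `linSymAt ↦ linSym04At`, `linKerAt ∕ linCountAt ∕ linAvgAt ↦ symLinKerAt ∕ symLinCountAt ∕ symLinAvgAt`
(an1's `SymAveragingHessianCounts`, d1's `SymmetrisedAxialPotential`), the `q¹`-pairing normalisation `(L^{d+1})⁻¹ ↦ ((d+1)!·L^{d+1})⁻¹` (leaf-02 g55 `SymLinKernelExpansion.tsum_sum_symLinKerAt_mul`)
and the count constant `L^{d+1}·ℓ ↦ (d+1)!·(L^{d+1}·ℓ)` (an1's `abs_symLinCountAt_le`, leaf-01 g90's `SymContactFaceJumpCommutator.sum_abs_symLinCountAt_le`) carried VERBATIM through every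
statement; every TABLE-FREE lemma of the (E) files is consumed BY NAME (not copied), and leaf-01 g90's `SymContactFaceJump ∕ SymContactFaceJumpCommutator` supply the shared sym
count ∕ commutator letters.  [folklore] bookkeeping; 0 `def`, 0 cited fact, 0 `def … : Prop`, 0 sorry; NO estimate of Bałaban's beyond an1's DEFINED kernels.
HONEST FRAMING (cell contract, verbatim): «discharging `BetaPertH` makes Bałaban's UV stability UNCONDITIONAL — a real constructive-QFT result; it is NOT the continuum limit
and NOT the Clay problem.»  HONEST DEPENDENCY (verbatim): «continuum YM on T⁴ ⇐ BetaPertH ∧ nine spine estimates (0/9 proved); BetaPertH ⇐ (D1) ∧ (D4) ∧ CAP+tail; G-an2-4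
gates asym, D1 and NE2/3/4.»  Discharges NO letter of M.104 ∕ of the OWNER's END `CombChargeRowsOfBornContactLetters` (hCv ∕ hPcV stay HYPOTHESES); NEVER «G-an2-4 closed» as
(CONV-C); NOT D1, NOT BetaPertH, NOT continuum, NOT Clay.  2026-08-28; no existing file touched.

## What (same statements as the (E) file under the substitutions above; `Sym…` namespace)
`abs_contact_border_mf_le`.
-/

noncomputable section

open Finset
open scoped BigOperators
open Literature.MathematicalPhysics.QuantumFieldTheory
open Literature.MathematicalPhysics.QuantumFieldTheory.LatticeForm (quo)
open Literature.MathematicalPhysics.QuantumFieldTheory.Balaban1983to89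
open Literature.MathematicalPhysics.QuantumFieldTheory.Balaban1983to89.Beta
open B4ContourShift (supNorm supNorm_nonneg)
open ExpKernelCalculus (MKer Zl Zl_nonneg)
open AffineAveraging (Form0 Form1 Site box toSite unitVec dz)
open AveragingContours (blk off)

open AveragingHessianKernels (ell)

open OneStepResolventKernel (Fib)
open Summit.QuantumFields.BalabanUV.Beta.GAN24.SrecLinearPartEq (reslot)
open Summit.QuantumFields.BalabanUV.Beta.GAN24.Push3 (push₃)
open Summit.QuantumFields.BalabanUV.Beta.GAN24.Push3LegTelescope (abs_le_of_env' summable_of_env')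
open Summit.QuantumFields.BalabanUV.Beta.GAN24.SymContactFaceJumpBorder (tipCommutator_eq_sum)
open Summit.QuantumFields.BalabanUV.Beta.GAN24.SymContactBorderCommutator (contact_border_mf_eq_factorised)
open Summit.QuantumFields.BalabanUV.Beta.GAN24.SymContactBorderEntryBound (abs_sum_tsum_tip_le abs_sum_tsum_root_le abs_sum_tsum_tip_dz_le)
open Summit.QuantumFields.BalabanUV.Beta.GAN24.ContactBorderEntryBound (tsum_sum_mul_ite_off_eq)

open Summit.QuantumFields.BalabanUV.Beta.SymmetrisedAxialPotential (symLinAvgAt)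

open Summit.QuantumFields.BalabanUV.Beta.SymAveragingHessianCounts (symVhSAt symVhSAt_symm locStencil_symVhSAt symLinCountAt symLinKerAt abs_symLinCountAt_le abs_symLinKerAt_le symLinCountAt_eq_zero symLinKerAt_eq_zero)

namespace Summit.QuantumFields.BalabanUV.Beta.GAN24.SymContactBorderEntryBoundMf

variable {d : ℕ} {Lc : ℕ} [NeZero Lc] {rr : Fin (d + 1) → ℕ} {n : ℕ} {κ αg KB CT CM Tb : ℝ}
  {T B M : Fin (d + 1) → (Fin (d + 1) → ℤ) → Fin (d + 1) → (Fin (d + 1) → ℤ) → ℝ}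
  {lam : Fin (d + 1) → (Fin (d + 1) → ℤ) → (Fin (d + 1) → ℤ) → ℝ}
  {G : Fin (d + 1) → (Fin (d + 1) → ℤ) → ℕ → Site (d + 1) → ℝ}

/-- NOT IN PRINT; OUR BOOKKEEPING ([folklore]; every analytic input a LETTER).  **THE ENTRY BOUND OF THE mf-CHANNEL V CONTACT DIFFERENCE.**  Legs `T` (dressed: bounded with summable fine
slices) and `B` (undressed: block envelope at blocking `Lc^{n+1}`) with `T − B = dz λ`, the bond gauge functions staircases with localised geometric pieces, the COMMON multiplier LEFT leg `M`
(bounded, summable fine slices) under the TENT letter `|M α x′ μ (Lc•y)| ≤ T_b·e^{−κ‖quo (Lc^n) y − x′‖∞}`.  THEN for all `κ′ u′ x′ z′ α β`, with `V_ρ = symVhSAt ρ d Lc`,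
`|push₃ M T T (reslot inr inl V_ρ) κ′u′ x′z′ (inl α)(inl β) − push₃ M B B (reslot inr inl V_ρ) κ′u′ x′z′ (inl α)(inl β)|`
`≤ (Lc^{d+1})⁻¹·((d+1)·T_b·(E₀²·Cnt))·(2·K_B·(2α_g + 2α_g·Lc·n) + (4α_g² + 8α_g²·Lc·n))·((Lc^n)^{d+1}·Zl(κ∕(4(d+1))))·e^{−(κ∕12)(‖z′−x′‖∞ + ‖u′−x′‖∞)}`. -/
theorem abs_contact_border_mf_le (hLc : 1 ≤ Lc) (hrr : rr ∈ box (d + 1) Lc) (hκ : 0 < κ) (hαg : 0 ≤ αg) (hKB : 0 ≤ KB) (hTb : 0 ≤ Tb)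
    (hT : ∀ μ z κ u, |T μ z κ u| ≤ CT) (hTs : ∀ μ z κ, Summable fun u => T μ z κ u)
    (hB : ∀ μ z l u, |B μ z l u| ≤ KB * Real.exp (-(κ * supNorm (quo (Lc ^ (n + 1)) u - z))))
    (hTB : T - B = fun μ z κ u => dz (lam μ z) κ u)
    (hψ : ∀ μ₀ z₀ u, lam μ₀ z₀ u = ∑ s ∈ Finset.range (n + 1), G μ₀ z₀ s (blk (Lc ^ s) u))
    (hG : ∀ μ₀ z₀ s, s ≤ n → ∀ u, |G μ₀ z₀ s (blk (Lc ^ s) u)| ≤ αg * (Lc : ℝ) ^ s * Real.exp (-(κ * supNorm (quo (Lc ^ (n + 1)) u - z₀))))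
    (hM : ∀ α x' μ x, |M α x' μ x| ≤ CM) (hMs : ∀ α x' μ, Summable fun x => M α x' μ x)
    (hMt : ∀ (α : Fin (d + 1)) (x' : Site (d + 1)) (μ : Fin (d + 1)) (y : Site (d + 1)),
      |M α x' μ ((Lc : ℤ) • y)| ≤ Tb * Real.exp (-(κ * supNorm (quo (Lc ^ n) y - x'))))
    (κ' : Fin (d + 1)) (u' x' z' : Site (d + 1)) (α β : Fin (d + 1)) :
    |push₃ M T T (reslot Sum.inr Sum.inl (symVhSAt (toSite rr) d Lc rfl)) κ' u' x' z' (Sum.inl α) (Sum.inl β)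
        - push₃ M B B (reslot Sum.inr Sum.inl (symVhSAt (toSite rr) d Lc rfl)) κ' u' x' z' (Sum.inl α) (Sum.inl β)|
      ≤ ((((d + 1).factorial : ℕ) : ℝ) * (Lc : ℝ) ^ (d + 1))⁻¹ *
          ((((d : ℝ) + 1) * Tb * (Real.exp (2 * ((d : ℝ) + 1) * κ) ^ 2 *
              (((2 * Lc : ℕ) : ℝ) ^ (d + 1) * (((d + 1 : ℕ) : ℝ) * ((((d + 1).factorial : ℕ) : ℝ) * ((Lc : ℝ) ^ (d + 1) * (ell (d + 1) Lc : ℝ)))))))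
            * (2 * KB * (2 * αg + 2 * αg * Lc * n) + (4 * αg ^ 2 + 2 * (4 * αg ^ 2) * Lc * n))
            * ((((Lc ^ n : ℕ) : ℝ)) ^ (d + 1) * Zl (d + 1) (κ / (4 * ((d : ℝ) + 1))))
            * Real.exp (-(κ / 12) * (supNorm (z' - x') + supNorm (u' - x')))) := by
  -- the leg class of `B` and the socket
  have hLn1 : 1 ≤ Lc ^ (n + 1) := Nat.one_le_pow _ _ hLc
  have hBb : ∀ μ z l u, |B μ z l u| ≤ KB := abs_le_of_env' hκ.le hB
  have hBs : ∀ μ z l, Summable fun u => B μ z l u := summable_of_env' hLn1 hκ hB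
  rw [contact_border_mf_eq_factorised hLc hrr hM hMs hT hTs hBb hBs hT hBb hTB hTB κ' u' x' z' α β]
  -- sublattice re-indexing of the two cells
  rw [tsum_sum_mul_ite_off_eq hLc (fun a x => M α x' a x) (fun a y x => ((((d + 1).factorial : ℕ) : ℝ) * (Lc : ℝ) ^ (d + 1))⁻¹ *
      (symLinAvgAt (toSite rr) (fun κ u => lam β z' (u + unitVec κ) * T κ' u' κ u) Lc a y
        - lam β z' (x + toSite rr + (Lc : ℤ) • unitVec a) * symLinAvgAt (toSite rr) (T κ' u') Lc a y)),
    tsum_sum_mul_ite_off_eq hLc (fun a x => M α x' a x) (fun a y x => ((((d + 1).factorial : ℕ) : ℝ) * (Lc : ℝ) ^ (d + 1))⁻¹ *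
      (lam κ' u' (x + toSite rr) * symLinAvgAt (toSite rr) (B β z') Lc a y
        - symLinAvgAt (toSite rr) (fun b z => lam κ' u' z * B β z' b z) Lc a y))]
  -- the split of the TIP cell's dressed leg `T κ′ u′ = B κ′ u′ + dz (λ κ′ u′)`
  have eT : ∀ b z, T κ' u' b z = B κ' u' b z + dz (lam κ' u') b z := fun b z => by
    have h := congrFun (congrFun (congrFun (congrFun hTB κ') u') b) z
    simp only [Pi.sub_apply] at h
    linarith
  have hsplit : ∀ a y,
      symLinAvgAt (toSite rr) (fun b z => lam β z' (z + unitVec b) * T κ' u' b z) Lc a y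
          - lam β z' ((Lc : ℤ) • y + toSite rr + (Lc : ℤ) • unitVec a) * symLinAvgAt (toSite rr) (T κ' u') Lc a y
        = (symLinAvgAt (toSite rr) (fun b z => lam β z' (z + unitVec b) * B κ' u' b z) Lc a y
            - lam β z' ((Lc : ℤ) • y + toSite rr + (Lc : ℤ) • unitVec a) * symLinAvgAt (toSite rr) (B κ' u') Lc a y)
          + (symLinAvgAt (toSite rr) (fun b z => lam β z' (z + unitVec b) * dz (lam κ' u') b z) Lc a y
            - lam β z' ((Lc : ℤ) • y + toSite rr + (Lc : ℤ) • unitVec a) * symLinAvgAt (toSite rr) (dz (lam κ' u')) Lc a y) := by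
    intro a y
    rw [tipCommutator_eq_sum hrr, tipCommutator_eq_sum hrr, tipCommutator_eq_sum hrr (lam β z') (dz (lam κ' u')), ← Finset.sum_add_distrib]
    refine Finset.sum_congr rfl fun x _ => ?_
    rw [← Finset.sum_add_distrib]
    refine Finset.sum_congr rfl fun b _ => ?_
    rw [eT b x]; ring
  -- the three cells (brackets `b a y := M α x′ a (Lc•y)`, tent label `x′`)
  obtain ⟨hs1, hb1⟩ := abs_sum_tsum_tip_le (b := fun a y => M α x' a ((Lc : ℤ) • y)) (xg := z') (xl := u') (u' := x')
    hLc hrr hκ hαg hKB hTb (hψ β z') (hG β z') (fun b z => hB κ' u' b z) (hMt α x')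
  obtain ⟨hs2, hb2⟩ := abs_sum_tsum_tip_dz_le (b := fun a y => M α x' a ((Lc : ℤ) • y)) (xg := z') (xl := u') (u' := x')
    hLc hrr hκ hαg hTb (hψ β z') (hψ κ' u') (hG β z') (hG κ' u') (hMt α x')
  obtain ⟨hs3, hb3⟩ := abs_sum_tsum_root_le (b := fun a y => M α x' a ((Lc : ℤ) • y)) (xg := u') (xl := z') (u' := x')
    hLc hrr hκ hαg hKB hTb (hψ κ' u') (hG κ' u') (fun b z => hB β z' b z) (hMt α x')
  rw [add_comm (supNorm (u' - x')) (supNorm (z' - x'))] at hb3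
  -- regroup the first cell: constant out, split, exchange
  set c₀ : ℝ := ((((d + 1).factorial : ℕ) : ℝ) * (Lc : ℝ) ^ (d + 1))⁻¹ with hc₀
  have e1 : (∑' y : Site (d + 1), ∑ a, M α x' a ((Lc : ℤ) • y) * (c₀ *
        (symLinAvgAt (toSite rr) (fun κ u => lam β z' (u + unitVec κ) * T κ' u' κ u) Lc a y
          - lam β z' ((Lc : ℤ) • y + toSite rr + (Lc : ℤ) • unitVec a) * symLinAvgAt (toSite rr) (T κ' u') Lc a y)))
      = c₀ * ((∑ a, ∑' y : Site (d + 1), M α x' a ((Lc : ℤ) • y) *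
          (symLinAvgAt (toSite rr) (fun b z => lam β z' (z + unitVec b) * B κ' u' b z) Lc a y
            - lam β z' ((Lc : ℤ) • y + toSite rr + (Lc : ℤ) • unitVec a) * symLinAvgAt (toSite rr) (B κ' u') Lc a y))
        + ∑ a, ∑' y : Site (d + 1), M α x' a ((Lc : ℤ) • y) *
          (symLinAvgAt (toSite rr) (fun b z => lam β z' (z + unitVec b) * dz (lam κ' u') b z) Lc a y
            - lam β z' ((Lc : ℤ) • y + toSite rr + (Lc : ℤ) • unitVec a) * symLinAvgAt (toSite rr) (dz (lam κ' u')) Lc a y)) := by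
    have step1 : ∀ y : Site (d + 1), (∑ a, M α x' a ((Lc : ℤ) • y) * (c₀ *
        (symLinAvgAt (toSite rr) (fun κ u => lam β z' (u + unitVec κ) * T κ' u' κ u) Lc a y
          - lam β z' ((Lc : ℤ) • y + toSite rr + (Lc : ℤ) • unitVec a) * symLinAvgAt (toSite rr) (T κ' u') Lc a y)))
        = c₀ * ∑ a, (M α x' a ((Lc : ℤ) • y) *
            (symLinAvgAt (toSite rr) (fun b z => lam β z' (z + unitVec b) * B κ' u' b z) Lc a y
              - lam β z' ((Lc : ℤ) • y + toSite rr + (Lc : ℤ) • unitVec a) * symLinAvgAt (toSite rr) (B κ' u') Lc a y)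
          + M α x' a ((Lc : ℤ) • y) *
            (symLinAvgAt (toSite rr) (fun b z => lam β z' (z + unitVec b) * dz (lam κ' u') b z) Lc a y
              - lam β z' ((Lc : ℤ) • y + toSite rr + (Lc : ℤ) • unitVec a) * symLinAvgAt (toSite rr) (dz (lam κ' u')) Lc a y)) := by
      intro y
      rw [Finset.mul_sum]
      refine Finset.sum_congr rfl fun a _ => ?_
      rw [hsplit a y]; ring
    rw [tsum_congr step1, tsum_mul_left, Summable.tsum_finsetSum (fun a _ => (hs1 a).add (hs2 a))]
    congr 1
    rw [← Finset.sum_add_distrib]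
    exact Finset.sum_congr rfl fun a _ => (hs1 a).tsum_add (hs2 a)
  have e2 : (∑' y : Site (d + 1), ∑ a, M α x' a ((Lc : ℤ) • y) * (c₀ *
        (lam κ' u' ((Lc : ℤ) • y + toSite rr) * symLinAvgAt (toSite rr) (B β z') Lc a y
          - symLinAvgAt (toSite rr) (fun b z => lam κ' u' z * B β z' b z) Lc a y)))
      = c₀ * ∑ a, ∑' y : Site (d + 1), M α x' a ((Lc : ℤ) • y) *
          (lam κ' u' ((Lc : ℤ) • y + toSite rr) * symLinAvgAt (toSite rr) (B β z') Lc a y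
            - symLinAvgAt (toSite rr) (fun b z => lam κ' u' z * B β z' b z) Lc a y) := by
    rw [← Summable.tsum_finsetSum (fun a _ => hs3 a), ← tsum_mul_left]
    refine tsum_congr fun y => ?_
    rw [Finset.mul_sum]
    exact Finset.sum_congr rfl fun a _ => by ring
  rw [e1, e2, ← mul_add]
  have hc0 : 0 ≤ c₀ := by positivity
  rw [abs_mul, abs_of_nonneg hc0]
  refine (mul_le_mul_of_nonneg_left ((abs_add_le _ _).trans (add_le_add ((abs_add_le _ _).trans (add_le_add hb1 hb2)) hb3)) hc0).trans
    (le_of_eq ?_)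
  ring

end Summit.QuantumFields.BalabanUV.Beta.GAN24.SymContactBorderEntryBoundMf

end
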